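import Summits.SmoothPoincare4.SmoothPoincare4.Theorems.SullivanDualWitnessChargeReductionV8
import Literature.Geometry.Symplectic.JHolomorphicLimitEmbeddedProofs
import Literature.Geometry.Symplectic.JHolomorphicIsolatedIntersectionPersists
import Literature.Geometry.Symplectic.JHolomorphicWeierstrassProofs

/-!
# Crux `WitnessCharge` (stmt-SmoothPoincare4-7824) modulo `PencilLocalFamily` and McDuff's cusp theorem — reduction v9

Line `Sketch` (idea `pencil-incompleteness`), continuation lead c6, cycle 6. Since reduction v8
(`WitnessCharge_of_facts_homotopySphere : L2′ → L1b → WitnessCharge`, lead c5) the Literature side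
has moved: `jHolomorphic_isolatedIntersection_persists_holds` (McDuff 1991 Thm 1.1, persistence form)
and `JHolomorphicWeierstrassR4_holds` (Hummel 1997 III.3.1) are theorems, and
`jHolomorphicLimitOfEmbedded_isEmbedded_of_persist_of_noCusp` derives McDuff's limit theorem L1b from
persistence and the ABSENCE OF CUSPS in limits of embedded curves alone
(`Literature/Geometry/Symplectic/JHolomorphicLimitEmbeddedProofs.lean`). Hence:

* `helper_limitOfEmbeddedPlanes_of_noCusp` — the listed route item `LimitOfEmbeddedPlanes`
  (stmt-SmoothPoincare4-16809, `Iff.rfl`-equal to `jHolomorphicLimitOfEmbedded_isEmbedded`) follows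
  from the single local fact `jHolomorphic_immersed_of_limitEmbedded_punctured` (McDuff 1991 Thm 1.4,
  Cor. 4.4, Lemma 4.3);
* `helper_witnessCharge_of_pencilLocalFamily_of_noCusp` — the crux follows from the promoted crux
  `PencilLocalFamily` (stmt-SmoothPoincare4-16772) and that local fact;
* `helper_witnessCharge_of_pencilLocalFamily_of_flatCusp` — the crux follows from `PencilLocalFamily`
  and the FLAT, chart-level form of the cusp theorem (McDuff (5.6) with Cor. 4.4, Thm 1.4, Lemma
  4.2(i): a `J'`-holomorphic immersion `C¹`-close on a closed disc to a `J'`-holomorphic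
  embedding-except-at-the-critical-point-`0` is not injective), via Literature's
  `jHolomorphic_immersed_of_limitEmbedded_punctured_of_flat` fed with `JHolomorphicWeierstrassR4_holds`.

The trust base of the crux on this line is therefore `{PencilLocalFamily, flat cusp theorem}`.
-/

noncomputable section

set_option linter.dupNamespace false

open scoped Manifold ContDiff Topology
open Set Filter Metric Function Literature.Geometry.Kaehler Literature.Geometry.Symplectic
  Literature.Topology.FourManifolds

namespace Summit.SmoothPoincare4.SmoothPoincare4.Theorems.WitnessCharge.PencilIncompleteness

/-- **`LimitOfEmbeddedPlanes` from the no-cusp fact alone.** The route item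
`Theses.SullivanDual.LimitOfEmbeddedPlanes` (stmt-SmoothPoincare4-16809) is definitionally the
Literature named fact `jHolomorphicLimitOfEmbedded_isEmbedded` (McDuff 1991 §4), which Literature's
`jHolomorphicLimitOfEmbedded_isEmbedded_of_persist_of_noCusp` derives from the (proved) persistence of
isolated intersections and the absence of cusps in limits of embedded `J`-curves. -/
theorem helper_limitOfEmbeddedPlanes_of_noCusp :
    Literature.Geometry.Symplectic.jHolomorphic_immersed_of_limitEmbedded_punctured →
    Summit.SmoothPoincare4.SmoothPoincare4.Theses.SullivanDual.LimitOfEmbeddedPlanes :=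
  fun hCusp =>
    Literature.Geometry.Symplectic.jHolomorphicLimitOfEmbedded_isEmbedded_of_persist_of_noCusp
      Literature.Geometry.Symplectic.jHolomorphic_isolatedIntersection_persists_holds hCusp

/-- **The crux modulo the promoted crux `PencilLocalFamily` and the no-cusp fact.**
`PencilLocalFamily` (stmt-SmoothPoincare4-16772) is definitionally
`jPlanePencil_localFamily_homotopySphere`; compose `WitnessCharge_of_facts_homotopySphere` (v8) with
`helper_limitOfEmbeddedPlanes_of_noCusp`. -/
theorem helper_witnessCharge_of_pencilLocalFamily_of_noCusp :
    Summit.SmoothPoincare4.SmoothPoincare4.Theses.SullivanDual.PencilLocalFamily →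
    Literature.Geometry.Symplectic.jHolomorphic_immersed_of_limitEmbedded_punctured →
    Summit.SmoothPoincare4.SmoothPoincare4.Theses.SullivanDual.WitnessCharge :=
  fun hP hCusp =>
    WitnessCharge_of_facts_homotopySphere hP (helper_limitOfEmbeddedPlanes_of_noCusp hCusp)

/-- **The crux modulo `PencilLocalFamily` and the FLAT cusp theorem** (McDuff 1991 (5.6) p. 163
with Cor. 4.4, Thm 1.4, Lemma 4.2(i), sequential `C¹` form exactly as the hypothesis `hcusp` of
Literature's `jHolomorphic_immersed_of_limitEmbedded_punctured_of_flat`): for a smooth almost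
complex structure `J'` on `ℝ⁴`, a `J'`-holomorphic `f` on `ball 0 R`, injective on
`closedBall 0 r`, immersive there except at the critical point `0`, and `J'`-holomorphic immersions
`f'ₙ → f` with `df'ₙ → df` uniformly on `closedBall 0 r`, eventually `f'ₙ` is not injective on
`closedBall 0 r`. The `C⁰ ⇒ C¹` upgrade is `JHolomorphicWeierstrassR4_holds`. -/
theorem helper_witnessCharge_of_pencilLocalFamily_of_flatCusp :
    Summit.SmoothPoincare4.SmoothPoincare4.Theses.SullivanDual.PencilLocalFamily →
    (∀ (J' : EuclideanSpace ℝ (Fin 4) → EuclideanSpace ℝ (Fin 4) →L[ℝ]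
        EuclideanSpace ℝ (Fin 4)), ContDiff ℝ ∞ J' → (∀ x v, J' x (J' x v) = -v) →
      ∀ (f : ℂ → EuclideanSpace ℝ (Fin 4)) (r R : ℝ), 0 < r → r < R →
        ContDiffOn ℝ ∞ f (ball 0 R) →
        (∀ z ∈ ball (0 : ℂ) R, ∀ ζ : ℂ,
          fderiv ℝ f z (Complex.I * ζ) = J' (f z) (fderiv ℝ f z ζ)) →
        InjOn f (closedBall 0 r) →
        (∀ z ∈ closedBall (0 : ℂ) r, z ≠ 0 → Injective (fderiv ℝ f z)) →
        fderiv ℝ f 0 = 0 →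
        ∀ f' : ℕ → ℂ → EuclideanSpace ℝ (Fin 4), (∀ n, ContDiffOn ℝ ∞ (f' n) (ball 0 R)) →
          (∀ n, ∀ z ∈ ball (0 : ℂ) R, ∀ ζ : ℂ,
            fderiv ℝ (f' n) z (Complex.I * ζ) = J' (f' n z) (fderiv ℝ (f' n) z ζ)) →
          (∀ n, ∀ z ∈ closedBall (0 : ℂ) r, Injective (fderiv ℝ (f' n) z)) →
          TendstoUniformlyOn f' f atTop (closedBall 0 r) →
          TendstoUniformlyOn (fun n => fderiv ℝ (f' n)) (fderiv ℝ f) atTop (closedBall 0 r) →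
          ∀ᶠ n in atTop, ¬ InjOn (f' n) (closedBall 0 r)) →
    Summit.SmoothPoincare4.SmoothPoincare4.Theses.SullivanDual.WitnessCharge :=
  fun hP hcusp =>
    helper_witnessCharge_of_pencilLocalFamily_of_noCusp hP
      (Literature.Geometry.Symplectic.jHolomorphic_immersed_of_limitEmbedded_punctured_of_flat
        Literature.Geometry.Symplectic.JHolomorphicWeierstrassR4_holds hcusp)

end Summit.SmoothPoincare4.SmoothPoincare4.Theorems.WitnessCharge.PencilIncompleteness
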